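import Summits.Ventures.HodgeRepro2.T5SU11WeightedSpaceGroundState
import Summits.Ventures.HodgeRepro2.T5SU11WeightedSpaceGroundStateOrder

/-!
# The iterates of the resolvent on `W_1` as functions of the spectral parameter: the difference recursion and the
weighted Lipschitz bound

For `g ∈ W_1 = {|g| ≤ D Ξ}` and `λ, λ₂ > 1` put `D_n = (G^I_λ)ⁿ g − (G^I_{λ₂})ⁿ g`. Linearity of the resolvent in the source and
row 500's resolvent identity give the recursion **`D_{n+1} = G^I_λ D_n + (μ − μ₂) G^I_λ (G^I_{λ₂})^{n+1} g`**, and row 556's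
sharp bound on `W_1` then gives, with `m = min((λ − 1)², (λ₂ − 1)²)`,

* `greenSolI_add_ground`, `greenSolI_sub_ground` — **`G^I_λ (g₁ ± g₂) = G^I_λ g₁ ± G^I_λ g₂`** on `W_1`;
* `iterate_sub_succ` — the difference recursion;
* `abs_iterate_sub_le` — **`|(G^I_λ)ⁿ g(t) − (G^I_{λ₂})ⁿ g(t)| ≤ |μ − μ₂| · n D Ξ(t)/m^{n+1}`**: the iterates are Lipschitz in
  `μ` in the `Ξ`-weighted sup-norm, uniformly in `t`;
* `tendsto_iterate_lam` — **`λ ↦ (G^I_λ)ⁿ g(t)` is continuous at every `λ₂ > 1`**.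

Nothing is claimed about (N).

Blind lane: Mathlib + the HodgeRepro2 prefix only; no sorry; axioms ⊆ {propext, Classical.choice,
Quot.sound}.
-/

namespace Summit.Ventures.HodgeRepro2.T5SU11WeightedSpaceGroundStateIterateDiff

open Filter Topology MeasureTheory
open Set (Ioi Ioc)
open T5SU11Cartan T5SU11SphericalFunction T5SU11SphericalDecay T5SU11RadialGreenImproper
  T5SU11RadialGreenImproperDecaySource T5SU11ResolventIdentityDecay T5SU11ResolventGroundStateWeight
  T5SU11WeightedSpaceGroundState T5SU11WeightedSpaceGroundStateOrder T5SU11SphericalBounds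

/-- **`G^I(g₁ + g₂) = G^I g₁ + G^I g₂`** given the integrability of both sources against the basis (`t > 0`). -/
theorem greenSolI_add_source {φ χ g₁ g₂ : ℝ → ℝ}
    (hB₁ : ∀ T, IntegrableOn (fun s => φ s * g₁ s * Real.sinh (2 * s)) (Ioc 0 T))
    (hA₁ : IntegrableOn (fun s => χ s * g₁ s * Real.sinh (2 * s)) (Ioi 0))
    (hB₂ : ∀ T, IntegrableOn (fun s => φ s * g₂ s * Real.sinh (2 * s)) (Ioc 0 T))
    (hA₂ : IntegrableOn (fun s => χ s * g₂ s * Real.sinh (2 * s)) (Ioi 0)) {t : ℝ} (ht : 0 < t) :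
    greenSolI φ χ (fun s => g₁ s + g₂ s) t = greenSolI φ χ g₁ t + greenSolI φ χ g₂ t := by
  unfold greenSolI greenBI greenAI
  have e1 : (fun s => φ s * (g₁ s + g₂ s) * Real.sinh (2 * s))
      = fun s => φ s * g₁ s * Real.sinh (2 * s) + φ s * g₂ s * Real.sinh (2 * s) := by
    funext s; ring
  have e2 : (fun s => χ s * (g₁ s + g₂ s) * Real.sinh (2 * s))
      = fun s => χ s * g₁ s * Real.sinh (2 * s) + χ s * g₂ s * Real.sinh (2 * s) := by
    funext s; ring
  have hA₁' : IntegrableOn (fun s => χ s * g₁ s * Real.sinh (2 * s)) (Ioi t) :=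
    hA₁.mono_set (Set.Ioi_subset_Ioi ht.le)
  have hA₂' : IntegrableOn (fun s => χ s * g₂ s * Real.sinh (2 * s)) (Ioi t) :=
    hA₂.mono_set (Set.Ioi_subset_Ioi ht.le)
  rw [e1, e2, MeasureTheory.integral_add (hB₁ t) (hB₂ t), MeasureTheory.integral_add hA₁' hA₂']
  ring

section measure

variable [MeasurableSpace Circle] [BorelSpace Circle]

variable {lam : ℝ} (hlam : 1 < lam)

include hlam in
/-- **`G^I_λ (g₁ + g₂) = G^I_λ g₁ + G^I_λ g₂`** for two sources in `W_1`. -/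
theorem greenSolI_add_ground {g₁ g₂ : ℝ → ℝ} (hg₁ : ContinuousOn g₁ (Ioi 0)) (hg₂ : ContinuousOn g₂ (Ioi 0))
    {D₁ D₂ : ℝ} (hD₁ : ∀ s, 0 < s → |g₁ s| ≤ D₁ * sph 1 (hyp s)) (hD₂ : ∀ s, 0 < s → |g₂ s| ≤ D₂ * sph 1 (hyp s))
    {t : ℝ} (ht : 0 < t) :
    greenSolI (fun t => sph lam (hyp t)) (sphDecay lam) (fun s => g₁ s + g₂ s) t
      = greenSolI (fun t => sph lam (hyp t)) (sphDecay lam) g₁ t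
        + greenSolI (fun t => sph lam (hyp t)) (sphDecay lam) g₂ t := by
  obtain ⟨hM₁, hD₁0, hε, C₁, hC₁⟩ := class_of_le_mul_sph_one hlam hD₁
  obtain ⟨hM₂, hD₂0, _, C₂, hC₂⟩ := class_of_le_mul_sph_one hlam hD₂
  exact greenSolI_add_source (integrableOn_sph_mul_mul_sinh_Ioc hg₁ hM₁ hD₁0 lam)
    (integrableOn_sphDecay_mul_mul_sinh hlam hg₁ hM₁ hD₁0 hε hC₁)
    (integrableOn_sph_mul_mul_sinh_Ioc hg₂ hM₂ hD₂0 lam) (integrableOn_sphDecay_mul_mul_sinh hlam hg₂ hM₂ hD₂0 hε hC₂) ht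

include hlam in
/-- **`G^I_λ (g₁ − g₂) = G^I_λ g₁ − G^I_λ g₂`** for two sources in `W_1`. -/
theorem greenSolI_sub_ground {g₁ g₂ : ℝ → ℝ} (hg₁ : ContinuousOn g₁ (Ioi 0)) (hg₂ : ContinuousOn g₂ (Ioi 0))
    {D₁ D₂ : ℝ} (hD₁ : ∀ s, 0 < s → |g₁ s| ≤ D₁ * sph 1 (hyp s)) (hD₂ : ∀ s, 0 < s → |g₂ s| ≤ D₂ * sph 1 (hyp s))
    {t : ℝ} (ht : 0 < t) :
    greenSolI (fun t => sph lam (hyp t)) (sphDecay lam) (fun s => g₁ s - g₂ s) t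
      = greenSolI (fun t => sph lam (hyp t)) (sphDecay lam) g₁ t
        - greenSolI (fun t => sph lam (hyp t)) (sphDecay lam) g₂ t := by
  have hneg : ContinuousOn (fun s => -g₂ s) (Ioi 0) := hg₂.neg
  have hDneg : ∀ s, 0 < s → |(fun s => -g₂ s) s| ≤ D₂ * sph 1 (hyp s) := fun s hs => by
    simp only [abs_neg]; exact hD₂ s hs
  have h := greenSolI_add_ground hlam hg₁ hneg hD₁ hDneg ht
  simp only [← sub_eq_add_neg] at h
  rw [h, greenSolI_neg_source]
  ring

variable {lam₂ : ℝ} (hlam₂ : 1 < lam₂) {g : ℝ → ℝ} (hg : ContinuousOn g (Ioi 0))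
  {D : ℝ} (hD : ∀ s, 0 < s → |g s| ≤ D * sph 1 (hyp s))

include hlam hlam₂ hg hD in
/-- **The difference recursion of the iterates**:
`(G^I_λ)^{n+1} g − (G^I_{λ₂})^{n+1} g = G^I_λ ((G^I_λ)ⁿ g − (G^I_{λ₂})ⁿ g) + (μ − μ₂) G^I_λ ((G^I_{λ₂})^{n+1} g)` on `(0, ∞)`. -/
theorem iterate_sub_succ (n : ℕ) {t : ℝ} (ht : 0 < t) :
    ((greenSolI (fun t => sph lam (hyp t)) (sphDecay lam))^[n + 1] g) t
        - ((greenSolI (fun t => sph lam₂ (hyp t)) (sphDecay lam₂))^[n + 1] g) t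
      = greenSolI (fun t => sph lam (hyp t)) (sphDecay lam)
          (fun s => ((greenSolI (fun t => sph lam (hyp t)) (sphDecay lam))^[n] g) s
            - ((greenSolI (fun t => sph lam₂ (hyp t)) (sphDecay lam₂))^[n] g) s) t
        + (lam * (lam - 2) - lam₂ * (lam₂ - 2)) * greenSolI (fun t => sph lam (hyp t)) (sphDecay lam)
          ((greenSolI (fun t => sph lam₂ (hyp t)) (sphDecay lam₂))^[n + 1] g) t := by
  obtain ⟨hc₁, hb₁⟩ := iterate_mem_weighted_one hlam hg hD n
  obtain ⟨hc₂, hb₂⟩ := iterate_mem_weighted_one hlam₂ hg hD n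
  have hD₁ : ∀ s, 0 < s → |((greenSolI (fun t => sph lam (hyp t)) (sphDecay lam))^[n] g) s|
      ≤ (D / ((lam - 1) ^ 2) ^ n) * sph 1 (hyp s) := fun s hs => by rw [div_mul_eq_mul_div]; exact hb₁ s hs
  have hD₂ : ∀ s, 0 < s → |((greenSolI (fun t => sph lam₂ (hyp t)) (sphDecay lam₂))^[n] g) s|
      ≤ (D / ((lam₂ - 1) ^ 2) ^ n) * sph 1 (hyp s) := fun s hs => by rw [div_mul_eq_mul_div]; exact hb₂ s hs
  rw [greenSolI_sub_ground hlam hc₁ hc₂ hD₁ hD₂ ht, Function.iterate_succ_apply', Function.iterate_succ_apply']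
  -- the resolvent identity for the source `h = (G^I_{λ₂})ⁿ g ∈ W_1`
  have hmin : 1 < min lam lam₂ := lt_min hlam hlam₂
  obtain ⟨hM, hD0, hε, C, hC⟩ := class_of_le_mul_sph_one hmin hD₂
  have hε₁ : 2 - lam < (3 - min lam lam₂) / 2 := by linarith [min_le_left lam lam₂]
  have hε₂ : 2 - lam₂ < (3 - min lam lam₂) / 2 := by linarith [min_le_right lam lam₂]
  have hid := greenSolI_sub_greenSolI_eq hlam hlam₂ hc₂ hM hD0 hε₁ hε₂ hC ht
  linarith [hid]

include hlam hlam₂ hg hD in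
/-- **THE ITERATES ARE LIPSCHITZ IN `μ` IN THE `Ξ`-WEIGHTED SUP-NORM**: with `m = min((λ − 1)², (λ₂ − 1)²)`,
`|(G^I_λ)ⁿ g(t) − (G^I_{λ₂})ⁿ g(t)| ≤ |μ − μ₂| · n D Ξ(t)/m^{n+1}` for every `n` and `t > 0`. -/
theorem abs_iterate_sub_le (n : ℕ) {t : ℝ} (ht : 0 < t) :
    |((greenSolI (fun t => sph lam (hyp t)) (sphDecay lam))^[n] g) t
        - ((greenSolI (fun t => sph lam₂ (hyp t)) (sphDecay lam₂))^[n] g) t|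
      ≤ |lam * (lam - 2) - lam₂ * (lam₂ - 2)| * (n * D * sph 1 (hyp t)
        / (min ((lam - 1) ^ 2) ((lam₂ - 1) ^ 2)) ^ (n + 1)) := by
  set m := min ((lam - 1) ^ 2) ((lam₂ - 1) ^ 2) with hm
  have hp1 : 0 < (lam - 1) ^ 2 := by
    have : 0 < lam - 1 := by linarith
    positivity
  have hp2 : 0 < (lam₂ - 1) ^ 2 := by
    have : 0 < lam₂ - 1 := by linarith
    positivity
  have hm0 : 0 < m := lt_min hp1 hp2
  have hm1 : m ≤ (lam - 1) ^ 2 := min_le_left _ _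
  have hm2 : m ≤ (lam₂ - 1) ^ 2 := min_le_right _ _
  have hD0 : 0 ≤ D := (class_of_le_mul_sph_one hlam hD).2.1
  -- the bound in the form `∀ t > 0`, by induction
  suffices h : ∀ t, 0 < t → |((greenSolI (fun t => sph lam (hyp t)) (sphDecay lam))^[n] g) t
      - ((greenSolI (fun t => sph lam₂ (hyp t)) (sphDecay lam₂))^[n] g) t|
      ≤ |lam * (lam - 2) - lam₂ * (lam₂ - 2)| * (n * D / m ^ (n + 1)) * sph 1 (hyp t) by
    have := h t ht
    calc _ ≤ |lam * (lam - 2) - lam₂ * (lam₂ - 2)| * (n * D / m ^ (n + 1)) * sph 1 (hyp t) := this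
      _ = _ := by ring
  induction n with
  | zero => intro t ht; simp
  | succ n ih =>
    intro t ht
    set κ := |lam * (lam - 2) - lam₂ * (lam₂ - 2)| with hκ
    have hκ0 : 0 ≤ κ := abs_nonneg _
    -- the difference `D_n` is a continuous function in `W_1` with the constant `κ n D/m^{n+1}`
    obtain ⟨hc₁, _⟩ := iterate_mem_weighted_one hlam hg hD n
    obtain ⟨hc₂, hb₂⟩ := iterate_mem_weighted_one hlam₂ hg hD n
    have hcont : ContinuousOn (fun s => ((greenSolI (fun t => sph lam (hyp t)) (sphDecay lam))^[n] g) s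
        - ((greenSolI (fun t => sph lam₂ (hyp t)) (sphDecay lam₂))^[n] g) s) (Ioi 0) := hc₁.sub hc₂
    have hDn : ∀ s, 0 < s → |(fun s => ((greenSolI (fun t => sph lam (hyp t)) (sphDecay lam))^[n] g) s
        - ((greenSolI (fun t => sph lam₂ (hyp t)) (sphDecay lam₂))^[n] g) s) s|
        ≤ (κ * (n * D / m ^ (n + 1))) * sph 1 (hyp s) := fun s hs => ih s hs
    -- the two terms of the recursion
    have h1 := abs_greenSolI_le_mul_sph_one' hlam hcont hDn ht
    have hDh : ∀ s, 0 < s → |((greenSolI (fun t => sph lam₂ (hyp t)) (sphDecay lam₂))^[n + 1] g) s|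
        ≤ (D / ((lam₂ - 1) ^ 2) ^ (n + 1)) * sph 1 (hyp s) := fun s hs => by
      rw [div_mul_eq_mul_div]; exact (iterate_mem_weighted_one hlam₂ hg hD (n + 1)).2 s hs
    have h2 := abs_greenSolI_le_mul_sph_one' hlam (iterate_mem_weighted_one hlam₂ hg hD (n + 1)).1 hDh ht
    rw [iterate_sub_succ hlam hlam₂ hg hD n ht]
    -- monotonicity of the constants in `m`
    have hΞ : 0 < sph 1 (hyp t) := sph_hyp_pos 1 t
    have hmn : 0 < m ^ (n + 1) := pow_pos hm0 _
    have hmn2 : 0 < m ^ (n + 2) := pow_pos hm0 _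
    have hA : κ * (n * D / m ^ (n + 1)) * sph 1 (hyp t) / (lam - 1) ^ 2
        ≤ κ * (n * D / m ^ (n + 2)) * sph 1 (hyp t) := by
      rw [pow_succ m (n + 1)]
      have : κ * (n * D / m ^ (n + 1)) * sph 1 (hyp t) / (lam - 1) ^ 2
          = κ * (n * D / m ^ (n + 1)) * sph 1 (hyp t) * (1 / (lam - 1) ^ 2) := by ring
      rw [this]
      have e : κ * (n * D / (m ^ (n + 1) * m)) * sph 1 (hyp t)
          = κ * (n * D / m ^ (n + 1)) * sph 1 (hyp t) * (1 / m) := by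
        field_simp
      rw [e]
      apply mul_le_mul_of_nonneg_left _ (by positivity)
      exact one_div_le_one_div_of_le hm0 hm1
    have hB : κ * (D / ((lam₂ - 1) ^ 2) ^ (n + 1) * sph 1 (hyp t) / (lam - 1) ^ 2)
        ≤ κ * (D / m ^ (n + 2) * sph 1 (hyp t)) := by
      apply mul_le_mul_of_nonneg_left _ hκ0
      have e : D / ((lam₂ - 1) ^ 2) ^ (n + 1) * sph 1 (hyp t) / (lam - 1) ^ 2
          = D * sph 1 (hyp t) / (((lam₂ - 1) ^ 2) ^ (n + 1) * (lam - 1) ^ 2) := by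
        field_simp
      rw [e, div_mul_eq_mul_div]
      apply div_le_div_of_nonneg_left (by positivity) hmn2
      calc m ^ (n + 2) = m ^ (n + 1) * m := pow_succ m (n + 1)
        _ ≤ ((lam₂ - 1) ^ 2) ^ (n + 1) * (lam - 1) ^ 2 :=
          mul_le_mul (pow_le_pow_left₀ hm0.le hm2 _) hm1 hm0.le (by positivity)
    calc |greenSolI (fun t => sph lam (hyp t)) (sphDecay lam)
          (fun s => ((greenSolI (fun t => sph lam (hyp t)) (sphDecay lam))^[n] g) s
            - ((greenSolI (fun t => sph lam₂ (hyp t)) (sphDecay lam₂))^[n] g) s) t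
        + (lam * (lam - 2) - lam₂ * (lam₂ - 2)) * greenSolI (fun t => sph lam (hyp t)) (sphDecay lam)
          ((greenSolI (fun t => sph lam₂ (hyp t)) (sphDecay lam₂))^[n + 1] g) t|
        ≤ |greenSolI (fun t => sph lam (hyp t)) (sphDecay lam)
          (fun s => ((greenSolI (fun t => sph lam (hyp t)) (sphDecay lam))^[n] g) s
            - ((greenSolI (fun t => sph lam₂ (hyp t)) (sphDecay lam₂))^[n] g) s) t|
        + κ * |greenSolI (fun t => sph lam (hyp t)) (sphDecay lam)
          ((greenSolI (fun t => sph lam₂ (hyp t)) (sphDecay lam₂))^[n + 1] g) t| := by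
          rw [← abs_mul]; exact abs_add_le _ _
      _ ≤ κ * (n * D / m ^ (n + 1)) * sph 1 (hyp t) / (lam - 1) ^ 2
          + κ * (D / ((lam₂ - 1) ^ 2) ^ (n + 1) * sph 1 (hyp t) / (lam - 1) ^ 2) :=
          add_le_add h1 (mul_le_mul_of_nonneg_left h2 hκ0)
      _ ≤ κ * (n * D / m ^ (n + 2)) * sph 1 (hyp t) + κ * (D / m ^ (n + 2) * sph 1 (hyp t)) := add_le_add hA hB
      _ = κ * ((n + 1 : ℕ) * D / m ^ (n + 1 + 1)) * sph 1 (hyp t) := by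
          push_cast
          ring

include hlam₂ hg hD in
/-- **`λ ↦ (G^I_λ)ⁿ g(t)` is continuous at every `λ₂ > 1`** on `W_1`. -/
theorem tendsto_iterate_lam (n : ℕ) {t : ℝ} (ht : 0 < t) :
    Tendsto (fun l => ((greenSolI (fun t => sph l (hyp t)) (sphDecay l))^[n] g) t) (𝓝 lam₂)
      (𝓝 (((greenSolI (fun t => sph lam₂ (hyp t)) (sphDecay lam₂))^[n] g) t)) := by
  rw [tendsto_iff_norm_sub_tendsto_zero]
  have hp2 : 0 < (lam₂ - 1) ^ 2 := by
    have : 0 < lam₂ - 1 := by linarith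
    positivity
  -- the bound is continuous at `λ₂` and vanishes there
  have hc : ContinuousAt (fun l : ℝ => |l * (l - 2) - lam₂ * (lam₂ - 2)| * (n * D * sph 1 (hyp t)
      / (min ((l - 1) ^ 2) ((lam₂ - 1) ^ 2)) ^ (n + 1))) lam₂ := by
    apply ContinuousAt.mul
    · exact ((continuousAt_id.mul (continuousAt_id.sub continuousAt_const)).sub continuousAt_const).abs
    · apply ContinuousAt.div continuousAt_const
      · exact (((continuousAt_id.sub continuousAt_const).pow 2).min continuousAt_const).pow (n + 1)
      · simp only [min_self]
        positivity
  have hbound : Tendsto (fun l : ℝ => |l * (l - 2) - lam₂ * (lam₂ - 2)| * (n * D * sph 1 (hyp t)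
      / (min ((l - 1) ^ 2) ((lam₂ - 1) ^ 2)) ^ (n + 1))) (𝓝 lam₂) (𝓝 0) := by
    have h := hc.tendsto
    simpa only [sub_self, abs_zero, zero_mul] using h
  refine squeeze_zero_norm' ?_ hbound
  filter_upwards [eventually_gt_nhds hlam₂] with l hl
  simp only [Real.norm_eq_abs, abs_abs]
  exact abs_iterate_sub_le hl hlam₂ hg hD n ht

end measure

end Summit.Ventures.HodgeRepro2.T5SU11WeightedSpaceGroundStateIterateDiff
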